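import Summits.BirchSwinnertonDyer.Rank1Residual.Additive.RamifiedSevenGenusLevelIdentity
import Literature.GroupTheory.Abelian.MonoidHomSpanFunctions
import Mathlib.NumberTheory.NumberField.InfinitePlace.Embeddings
import HarnessLib

set_option autoImplicit false

/-!
# `𝒞₇` genus road (crux `EllipticUnitValueSevenOfGZK`, K7r), the (5)-unit programme (SUMMON GENUS-UNIT-A5), File C1 (memo S7,
# the ENGINE): FROM VANISHING χ-LOGARITHMS TO AN EXACT IDENTITY — if `Σ_{g ∈ Gal(L/ℚ)} χ(g)·log‖Φ(g V)‖ = 0` for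
# EVERY character `χ` of the abelian group `Gal(L/ℚ)`, and `V = U·c(U)` with `U` an algebraic integer, then `V = 1`
# (finite Fourier inversion + Kronecker's theorem; THEOREMS ONLY, no 7-adics, no regulator)

Cell bsd-cm, seat bsd-cm-k-ty1 g26 (literature-prover); ruled memo `pub/bsd-cm/bsd-cm-k-ty1/g26/G45-typing-memo.md` S7
(c225f82434dc25c5; pen D941 (ρ1)–(ρ4), D959/D961).  The step «Λ_χ(V) = 0 for ALL χ ⇒ every conjugate of V has absolute
value 1 ⇒ (V = U·c(U) is a positive real under Φ) V = 1» of S7, typed in general: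

* §1 FINITE FOURIER INVERSION on a finite commutative group (commutativity as a HYPOTHESIS `hcomm`, no instance):
  `eq_zero_of_forall_character_sum_eq_zero` — `(∀ χ : G →* ℂˣ, Σ_g χ(g)·f(g) = 0) ⇒ f = 0` (the characters SPAN the
  functions `G → ℂ`: tree `CharacterSpan.linearMap_apply_eq_zero_of_forall_monoidHom`).
* §2 KRONECKER: `eq_one_of_forall_norm_eq_one_of_pos` — an algebraic integer of a number field all of whose complex
  conjugates have absolute value `1` and ONE of whose conjugates is a positive real is `1` (Mathlib
  `NumberField.Embeddings.pow_eq_one_of_norm_eq_one`).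
* §3 `aut_comm_of_le_adjoin` — `Gal(L/ℚ)` is commutative for `L ≤ ℚ(ζ)` normal; `GenusFrame.layer_aut_comm` (the pin: `F′ₙ`).
* §4 `norm_embedding_eq_of_normal` — every complex embedding of a normal `L ⊂ ℚ̄` is `Φ ∘ g` for some `g ∈ Gal(L/ℚ)`;
  ★ `eq_one_of_forall_character_logSum_eq_zero` — THE ENGINE (display above).

HONEST LABEL: general algebra/number theory; no definition, no named fact, no instance; nothing closes;
stmt-BirchSwinnertonDyer-19945 OPEN; K1ᵘ NOT proved (S7's character computation C2 and S9 = File E ahead); `X12.CMRamifiedSeven`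
NOT proved; BSD is claimed for no curve; no summit statement is proved by this seat.

## References
* L. C. Washington, *Introduction to Cyclotomic Fields* (1997), §3 (Lemma 3.8 ff., orthogonality), Lemma 1.6 (Kronecker), §8.3
  (χ-components of units) [Washington1997].
* J.-P. Serre, *Linear Representations of Finite Groups* (1977) §2.4, §3.1 [SerreLinearRepresentations1977].
* S. Lang, *Cyclotomic Fields I–II* (1990) Ch. 3 §5 (PDF p. 71) [Lang1990]; T. Tsuji, J. Number Theory 78 (1999) §6 [Tsuji1999].
* Tree: `Literature/GroupTheory/Abelian/MonoidHomSpanFunctions.lean` (bsd-print-cf2), Files B2a/B3a (this seat),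
  `RamifiedSevenGenusSinnottNorm.lean` (`layer_le_adjoin_ζsys`), `RamifiedSevenGenusProjector.lean` (`normal_layer`).
-/

noncomputable section

open scoped NumberField ComplexConjugate
open Field

namespace Summit.BirchSwinnertonDyer.Rank1Residual.Additive.GenusSeven

/-! ## §1 Finite Fourier inversion (commutativity as a hypothesis) -/

section Fourier

/-- **Finite Fourier inversion**: on a finite group with commuting elements, a function all of whose character sums
`Σ_g χ(g)·f(g)` (`χ : G →* ℂˣ`) vanish is zero — the characters span `G → ℂ`.
[cite: SerreLinearRepresentations1977, §2.4 and §3.1] [cite: Washington1997, §3 (Lemma 3.8)] -/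
theorem eq_zero_of_forall_character_sum_eq_zero {G : Type} [Group G] [Finite G] (hcomm : ∀ a b : G, a * b = b * a)
    (f : G → ℂ) (h : ∀ χ : G →* ℂˣ, ∑ᶠ g : G, ((χ g : ℂˣ) : ℂ) * f g = 0) : f = 0 := by
  classical
  letI : CommGroup G := { (inferInstance : Group G) with mul_comm := hcomm }
  haveI : Fintype G := Fintype.ofFinite G
  -- the linear functional `u ↦ Σ_g u(g)·f(g)`
  let Λ : (G → ℂ) →ₗ[ℂ] ℂ := ∑ g : G, f g • LinearMap.proj g
  have hΛapply : ∀ u : G → ℂ, Λ u = ∑ g : G, f g * u g := fun u => by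
    simp only [Λ, LinearMap.coe_sum, Finset.sum_apply, LinearMap.smul_apply, LinearMap.coe_proj,
      Function.eval, smul_eq_mul]
  have hΛ : ∀ χ : G →* ℂ, Λ (χ : G → ℂ) = 0 := fun χ => by
    rw [hΛapply]
    have h1 := h χ.toHomUnits
    rw [finsum_eq_sum_of_fintype] at h1
    rw [← h1]
    exact Finset.sum_congr rfl fun g _ => by rw [MonoidHom.coe_toHomUnits, mul_comm]
  funext y
  have hy := Literature.GroupTheory.Abelian.CharacterSpan.linearMap_apply_eq_zero_of_forall_monoidHom G ℂ Λ hΛ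
    (Pi.single y 1)
  rw [hΛapply, Finset.sum_eq_single y (fun g _ hg => by rw [Pi.single_eq_of_ne hg, mul_zero])
    (fun hy' => absurd (Finset.mem_univ y) hy'), Pi.single_eq_same, mul_one] at hy
  exact hy

end Fourier

/-! ## §2 Kronecker: conjugates of absolute value one and one positive real conjugate -/

section Kronecker

/-- **Kronecker**: an algebraic integer `x` of a number field all of whose complex conjugates have absolute value `1`,
and some conjugate of which is a positive real number, equals `1` (`x` is a root of unity by Mathlib's
`NumberField.Embeddings.pow_eq_one_of_norm_eq_one`; a positive real root of unity is `1`). [cite: Washington1997, Lemma 1.6] -/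
theorem eq_one_of_forall_norm_eq_one_of_pos {L : Type} [Field L] [NumberField L] {x : L} (hxi : IsIntegral ℤ x)
    (hx : ∀ φ : L →+* ℂ, ‖φ x‖ = 1) {φ₀ : L →+* ℂ} {r : ℝ} (hr : 0 < r) (hφ₀ : φ₀ x = r) : x = 1 := by
  obtain ⟨n, hn, hxn⟩ := NumberField.Embeddings.pow_eq_one_of_norm_eq_one L ℂ hxi hx
  have h1 : ((r ^ n : ℝ) : ℂ) = 1 := by rw [Complex.ofReal_pow, ← hφ₀, ← map_pow, hxn, map_one]
  have h2 : r ^ n = 1 := by exact_mod_cast h1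
  have h3 : r = 1 := (pow_eq_one_iff_of_nonneg hr.le hn.ne').mp h2
  apply φ₀.injective
  rw [hφ₀, h3, map_one, Complex.ofReal_one]

end Kronecker

/-! ## §3 `Gal(L/ℚ)` is commutative for `L ≤ ℚ(ζ)` -/

section Commutative

/-- Every automorphism of a normal `L ⊂ ℚ̄` is the restriction of an automorphism of `ℚ̄`. [cite: Washington1997, Thm. 2.5] -/
theorem exists_absGal_restrict_eq (L : IntermediateField ℚ (AlgebraicClosure ℚ)) [Normal ℚ L] (g : L ≃ₐ[ℚ] L) :
    ∃ σ : AlgebraicClosure ℚ ≃ₐ[ℚ] AlgebraicClosure ℚ, ∀ x : L, ((g x : L) : AlgebraicClosure ℚ) = σ x := by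
  haveI : IsAlgClosure ℚ (AlgebraicClosure ℚ) := isAlgClosure_rat_algebraicClosure
  haveI : Normal ℚ (AlgebraicClosure ℚ) := IsAlgClosure.normal ℚ _
  refine ⟨g.liftNormal (AlgebraicClosure ℚ), fun x => ?_⟩
  have h := AlgEquiv.liftNormal_commutes g (AlgebraicClosure ℚ) x
  rw [IntermediateField.algebraMap_apply, IntermediateField.algebraMap_apply] at h
  exact h.symm

/-- An automorphism of `ℚ̄` sends a primitive `m`-th root of unity to a power of it. [cite: Washington1997, Thm. 2.5] -/
theorem exists_apply_eq_pow {m : ℕ} [NeZero m] {ζ : AlgebraicClosure ℚ} (hζ : IsPrimitiveRoot ζ m)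
    (σ : AlgebraicClosure ℚ ≃ₐ[ℚ] AlgebraicClosure ℚ) : ∃ k : ℕ, σ ζ = ζ ^ k := by
  obtain ⟨k, -, hk⟩ := hζ.eq_pow_of_pow_eq_one (ξ := σ ζ) (by rw [← map_pow, hζ.pow_eq_one, map_one])
  exact ⟨k, hk.symm⟩

/-- **`Gal(L/ℚ)` is commutative for a normal `L ≤ ℚ(ζ)`**: lifts to `ℚ̄` act on `ζ` by powers, and `ζ ↦ ζ^{kl} = ζ^{lk}`.
(Commutativity is delivered as an equation, not as an instance.) [cite: Washington1997, Thm. 2.5] -/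
theorem aut_comm_of_le_adjoin {m : ℕ} [NeZero m] {ζ : AlgebraicClosure ℚ} (hζ : IsPrimitiveRoot ζ m)
    (L : IntermediateField ℚ (AlgebraicClosure ℚ)) [Normal ℚ L] (hL : L ≤ IntermediateField.adjoin ℚ {ζ})
    (a b : L ≃ₐ[ℚ] L) : a * b = b * a := by
  obtain ⟨σ, hσ⟩ := exists_absGal_restrict_eq L a
  obtain ⟨τ, hτ⟩ := exists_absGal_restrict_eq L b
  obtain ⟨k, hk⟩ := exists_apply_eq_pow hζ σ
  obtain ⟨l, hl⟩ := exists_apply_eq_pow hζ τ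
  have hcomm : (σ * τ) ζ = (τ * σ) ζ := by
    rw [AlgEquiv.mul_apply, AlgEquiv.mul_apply, hl, map_pow, hk, map_pow, hl, ← pow_mul, ← pow_mul, mul_comm]
  ext x
  rw [AlgEquiv.mul_apply, AlgEquiv.mul_apply, hσ, hτ, hτ, hσ, ← AlgEquiv.mul_apply, ← AlgEquiv.mul_apply]
  exact apply_eq_of_apply_eq_of_le_adjoin hL hcomm x.2

/-- The pin: **`Gal(F′ₙ/ℚ)` is commutative** (`F′ₙ ≤ ℚ(ζsys n)`). [cite: Tsuji1999, §3 (p. 6, L1–5)] -/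
theorem GenusFrame.layer_aut_comm (F : GenusFrame) (n : ℕ) (a b : F.layer n ≃ₐ[ℚ] F.layer n) : a * b = b * a := by
  haveI : NeZero (7 ^ (n + 1) * F.d) := ⟨(Nat.lt_trans zero_lt_one (F.one_lt_level n)).ne'⟩
  haveI : Normal ℚ (F.layer n) := F.normal_layer n
  exact aut_comm_of_le_adjoin (F.isPrimitiveRoot_ζsys n) (F.layer n) (F.layer_le_adjoin_ζsys n) a b

end Commutative

/-! ## §4 The engine: vanishing χ-logarithms force `V = 1` -/

section Engine

/-- **Every complex embedding of a normal `L ⊂ ℚ̄` is `Φ ∘ g`** for some `g ∈ Gal(L/ℚ)` (`Φ` any embedding of `ℚ̄`):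
hence `‖φ V‖ = ‖Φ(g V)‖`. [cite: Washington1997, Thm. 2.5] -/
theorem exists_aut_embedding_eq (L : IntermediateField ℚ (AlgebraicClosure ℚ)) [Normal ℚ L]
    (Φ : AlgebraicClosure ℚ →+* ℂ) (φ : L →+* ℂ) :
    ∃ g : L ≃ₐ[ℚ] L, ∀ x : L, φ x = Φ ((g x : L) : AlgebraicClosure ℚ) := by
  letI : Algebra L ℂ := (Φ.comp (algebraMap L (AlgebraicClosure ℚ))).toAlgebra
  haveI : IsScalarTower ℚ L ℂ := IsScalarTower.of_algebraMap_eq fun q => by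
    simp only [RingHom.algebraMap_toAlgebra, eq_ratCast, map_ratCast]
  refine ⟨AlgHom.restrictNormal' φ.toRatAlgHom L, fun x => ?_⟩
  have h := AlgHom.restrictNormal_commutes φ.toRatAlgHom L x
  rw [Algebra.algebraMap_self, RingHom.id_apply, RingHom.toRatAlgHom_apply, RingHom.algebraMap_toAlgebra,
    RingHom.comp_apply, IntermediateField.algebraMap_apply] at h
  exact h.symm

/-- An element of `L ⊂ ℚ̄` is an algebraic integer iff it is one in `ℚ̄`. [folklore] -/
theorem isIntegral_coe_iff {L : IntermediateField ℚ (AlgebraicClosure ℚ)} (x : L) :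
    IsIntegral ℤ ((x : L) : AlgebraicClosure ℚ) ↔ IsIntegral ℤ x :=
  isIntegral_algHom_iff ((algebraMap L (AlgebraicClosure ℚ)).toIntAlgHom) (algebraMap L (AlgebraicClosure ℚ)).injective

/-- ★ **THE ENGINE of S7**: let `L ⊂ ℚ̄` be normal and finite over `ℚ` with `Gal(L/ℚ)` commutative, `Φ` a complex
embedding of `ℚ̄` and `c ∈ Gal(ℚ̄/ℚ)` with `Φ ∘ c = conj ∘ Φ`; let `U ∈ L` be a non-zero algebraic integer and `V ∈ L`
with `V = U·c(U)`.  If `Σ_{g ∈ Gal(L/ℚ)} χ(g)·log‖Φ(g V)‖ = 0` for EVERY character `χ : Gal(L/ℚ) →* ℂˣ`, then `V = 1`: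
Fourier inversion gives `log‖Φ(gV)‖ = 0` for all `g`, so every complex conjugate of the algebraic integer `V` has
absolute value `1` (all embeddings are `Φ ∘ g`), `V` is a root of unity (Kronecker), and `Φ(V) = ‖Φ U‖² > 0` forces
`V = 1`. [cite: Washington1997, Lemma 1.6 and §8.3] [cite: Lang1990, Ch. 3 §5 (PDF p. 71)] -/
theorem eq_one_of_forall_character_logSum_eq_zero (L : IntermediateField ℚ (AlgebraicClosure ℚ)) [Normal ℚ L]
    [FiniteDimensional ℚ L] (hcomm : ∀ a b : L ≃ₐ[ℚ] L, a * b = b * a) (Φ : AlgebraicClosure ℚ →+* ℂ)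
    {c : AlgebraicClosure ℚ ≃ₐ[ℚ] AlgebraicClosure ℚ} (hc : ∀ x : AlgebraicClosure ℚ, Φ (c x) = conj (Φ x))
    {U V : L} (hU0 : U ≠ 0) (hUi : IsIntegral ℤ U)
    (hV : ((V : L) : AlgebraicClosure ℚ) = ((U : L) : AlgebraicClosure ℚ) * c ((U : L) : AlgebraicClosure ℚ))
    (h : ∀ χ : (L ≃ₐ[ℚ] L) →* ℂˣ,
      ∑ᶠ g : L ≃ₐ[ℚ] L, ((χ g : ℂˣ) : ℂ) * (Real.log ‖Φ ((g V : L) : AlgebraicClosure ℚ)‖ : ℂ) = 0) :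
    V = 1 := by
  haveI : NumberField L := { to_charZero := inferInstance, to_finiteDimensional := inferInstance }
  -- `U`, `c U`, `V` are non-zero; `V` is an algebraic integer
  have hU0' : ((U : L) : AlgebraicClosure ℚ) ≠ 0 := fun h0 => hU0 (by exact_mod_cast h0)
  have hV0 : V ≠ 0 := by
    intro h0
    rw [h0, ZeroMemClass.coe_zero, eq_comm, mul_eq_zero] at hV
    exact hV.elim hU0' fun h1 => hU0' (by rwa [map_eq_zero] at h1)
  have hVi : IsIntegral ℤ V := by
    rw [← isIntegral_coe_iff, hV]
    exact ((isIntegral_coe_iff U).mpr hUi).mul (((isIntegral_coe_iff U).mpr hUi).map c.toAlgHom.toRingHom.toIntAlgHom)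
  -- (1) Fourier inversion: every `log‖Φ(g V)‖` vanishes
  have hlog := eq_zero_of_forall_character_sum_eq_zero hcomm _ h
  have hnorm : ∀ g : L ≃ₐ[ℚ] L, ‖Φ ((g V : L) : AlgebraicClosure ℚ)‖ = 1 := fun g => by
    have h1 : (Real.log ‖Φ ((g V : L) : AlgebraicClosure ℚ)‖ : ℂ) = 0 := congrFun hlog g
    have h2 : Real.log ‖Φ ((g V : L) : AlgebraicClosure ℚ)‖ = 0 := by exact_mod_cast h1
    have hgV : (g V : L) ≠ 0 := (map_ne_zero g).mpr hV0
    have hne : ‖Φ ((g V : L) : AlgebraicClosure ℚ)‖ ≠ 0 := by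
      rw [norm_ne_zero_iff, map_ne_zero]
      exact_mod_cast hgV
    rcases Real.log_eq_zero.mp h2 with h3 | h3 | h3
    · exact absurd h3 hne
    · exact h3
    · exact absurd h3 fun h4 => by linarith [norm_nonneg (Φ ((g V : L) : AlgebraicClosure ℚ))]
  -- (2) all complex conjugates of `V` have absolute value `1`
  have hall : ∀ φ : L →+* ℂ, ‖φ V‖ = 1 := fun φ => by
    obtain ⟨g, hg⟩ := exists_aut_embedding_eq L Φ φ
    rw [hg]
    exact hnorm g
  -- (3) `Φ(V) = ‖Φ U‖² > 0`
  have hpos : 0 < ‖Φ ((U : L) : AlgebraicClosure ℚ)‖ ^ 2 := pow_pos (norm_pos_iff.mpr ((map_ne_zero Φ).mpr hU0')) 2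
  refine eq_one_of_forall_norm_eq_one_of_pos hVi hall (φ₀ := Φ.comp (algebraMap L (AlgebraicClosure ℚ))) hpos ?_
  rw [RingHom.comp_apply, IntermediateField.algebraMap_apply, hV, map_mul, hc, Complex.mul_conj, Complex.normSq_eq_norm_sq]

end Engine

end Summit.BirchSwinnertonDyer.Rank1Residual.Additive.GenusSeven

end
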